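import Summits.BirchSwinnertonDyer.BirchSwinnertonDyer.Theorems.ResidualThetaTransportAtTwoThetaLayerLambdaCongruenceAtTwoCuspSpanGenerationB1
import HarnessLib

/-!
# Node (G′)_N = `CuspSpanEvenAtTwo N` (item 27436; cruxes Kμ⁺ 20689 / Kan⁺ 20688 / 21437): TOOLS for the generation theorem at the
# composite levels `N = p·q`, `N = p²·q` — second columns, Farey transfer, the `−I` twist, `|d| ≤ 1`, and the arithmetic of `N = p^a q`

Cell `bsd-wall`, lead `bsd-wall-rtt-p4` g9 (crux Kμ⁺ stmt-BirchSwinnertonDyer-20689, line `birth`, stub `stub_flatMuZeroAtTwo` ⟸ node 27436).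
THEOREMS ONLY (no `def`, no named fact, no `sorry`); helper `--supports` the crux; BSD is not proved by this. Part 1 of 2: the matrix and
arithmetic bookkeeping consumed by `…CuspSpanGenerationTwoPrimes` (the generation theorem `TwoPrimes.chi_eq_zero_of_forall_b1` and its
node corollary). Contents (namespace `…SignedMuAtTwo.TwoPrimes`):

* `inv_mul_entries`, `chi_eq_of_secondCol` — **Farey transfer**: two elements of `Γ₀(N)` whose second columns `(b,d)`, `(b′,d′)` satisfy
  `|d b′ − b d′| ≤ 1` have the same value under every additive `χ` killing the small-trace elements and the `|b| = 1` elements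
  (`γ⁻¹γ′` has upper-right entry `d b′ − b d′`);
* `exists_gamma0_secondCol` — an element of `Γ₀(N)` with prescribed second column `(b, d)` (`gcd(b,d) = 1`, `d` prime to `N`);
* `exists_neg` — the `−I` twist; `chi_eq_zero_of_natAbs_d_le_one` — elements with `|d| ≤ 1` are killed (`N ≥ 2`);
* `isCoprime_iff_not_dvd`, `split_of_bad_bad`, `dvd_mul_sq` — at `N = p^a q`: `d` prime to `N` iff `p ∤ d ∧ q ∤ d`; two coprime non-units
  split the primes; and (the only use of `a ≤ 2`) `p ∣ s ⟹ N ∣ q s²`, which puts the parabolic `I + w·y yᵀJ` (`w = ±q`) in `Γ₀(N)`.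

References: R. S. Kulkarni, Amer. J. Math. 113 (1991) 1053–1133 (Farey symbols) [Kulkarni1991]; H. Rademacher, Abh. Math. Sem. Hamburg 7
(1929) [Rademacher1929]; A. W. Knapp, *Elliptic curves* (1992) Prop. 11.22 [Knapp1993].
-/

set_option autoImplicit false
set_option linter.dupNamespace false

open scoped MatrixGroups

open CongruenceSubgroup

namespace Summit.BirchSwinnertonDyer.BirchSwinnertonDyer.Theorems.SignedMuAtTwo

namespace TwoPrimes

variable {N : ℕ} {χ : Gamma0 N → ZMod 2}

/-! ## §1. Matrix bookkeeping: second columns, Farey adjacency, the `−I` twist, the `|d| ≤ 1` elements -/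

/-- Entries of `γ⁻¹ γ'` in the second column and the upper-left corner (`γ⁻¹ = (d, −b; −c, a)`). [folklore] -/
theorem inv_mul_entries (γ γ' : Gamma0 N) :
    ((γ⁻¹ * γ' : Gamma0 N) : SL(2, ℤ)) 0 1 =
        (γ : SL(2, ℤ)) 1 1 * (γ' : SL(2, ℤ)) 0 1 - (γ : SL(2, ℤ)) 0 1 * (γ' : SL(2, ℤ)) 1 1 ∧
      ((γ⁻¹ * γ' : Gamma0 N) : SL(2, ℤ)) 1 1 =
        -(γ : SL(2, ℤ)) 1 0 * (γ' : SL(2, ℤ)) 0 1 + (γ : SL(2, ℤ)) 0 0 * (γ' : SL(2, ℤ)) 1 1 ∧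
      ((γ⁻¹ * γ' : Gamma0 N) : SL(2, ℤ)) 0 0 =
        (γ : SL(2, ℤ)) 1 1 * (γ' : SL(2, ℤ)) 0 0 - (γ : SL(2, ℤ)) 0 1 * (γ' : SL(2, ℤ)) 1 0 := by
  have h00 : ((γ⁻¹ : Gamma0 N) : SL(2, ℤ)) 0 0 = (γ : SL(2, ℤ)) 1 1 := by
    rw [InvMemClass.coe_inv, Matrix.SpecialLinearGroup.SL2_inv_expl]; rfl
  have h01 : ((γ⁻¹ : Gamma0 N) : SL(2, ℤ)) 0 1 = -(γ : SL(2, ℤ)) 0 1 := by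
    rw [InvMemClass.coe_inv, Matrix.SpecialLinearGroup.SL2_inv_expl]; rfl
  have h10 : ((γ⁻¹ : Gamma0 N) : SL(2, ℤ)) 1 0 = -(γ : SL(2, ℤ)) 1 0 := by
    rw [InvMemClass.coe_inv, Matrix.SpecialLinearGroup.SL2_inv_expl]; rfl
  have h11 : ((γ⁻¹ : Gamma0 N) : SL(2, ℤ)) 1 1 = (γ : SL(2, ℤ)) 0 0 := by
    rw [InvMemClass.coe_inv, Matrix.SpecialLinearGroup.SL2_inv_expl]; rfl
  refine ⟨?_, ?_, ?_⟩
  · rw [gamma0_mul_apply_zero_one, h00, h01]; ring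
  · rw [gamma0_mul_apply_one_one', h10, h11]
  · rw [gamma0_mul_apply_zero_zero', h00, h01]; ring

/-- **Farey transfer.** If the second columns `(b, d)`, `(b', d')` of `γ, γ' ∈ Γ₀(N)` satisfy `|d b' − b d'| ≤ 1` (equal cusps or Farey
neighbours), then `χ γ = χ γ'` for every additive `χ` killing the small-trace elements and the `|b| = 1` elements: `γ⁻¹γ'` has upper-right
entry `d b' − b d'`, so it is either a `|b| = 1` element or (`= 0`) the parabolic `(1 0; * 1)`. [cite: Kulkarni1991, §2] -/
theorem chi_eq_of_secondCol (hadd : ∀ γ δ : Gamma0 N, χ (γ * δ) = χ γ + χ δ)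
    (hsmall : ∀ γ : Gamma0 N, ((γ : SL(2, ℤ)) 0 0 + (γ : SL(2, ℤ)) 1 1).natAbs ≤ 2 → χ γ = 0)
    (hB1 : ∀ β : Gamma0 N, ((β : SL(2, ℤ)) 0 1).natAbs = 1 → χ β = 0) (γ γ' : Gamma0 N)
    (hdet : ((γ : SL(2, ℤ)) 1 1 * (γ' : SL(2, ℤ)) 0 1 - (γ : SL(2, ℤ)) 0 1 * (γ' : SL(2, ℤ)) 1 1).natAbs ≤ 1) :
    χ γ = χ γ' := by
  obtain ⟨e01, e11, e00⟩ := inv_mul_entries γ γ'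
  have hβ : χ (γ⁻¹ * γ') = 0 := by
    rcases Nat.lt_or_ge (((γ : SL(2, ℤ)) 1 1 * (γ' : SL(2, ℤ)) 0 1 -
        (γ : SL(2, ℤ)) 0 1 * (γ' : SL(2, ℤ)) 1 1).natAbs) 1 with h0 | h1
    · -- equal second columns: `γ⁻¹γ' = (1 0; * 1)`
      have hz : (γ : SL(2, ℤ)) 1 1 * (γ' : SL(2, ℤ)) 0 1 - (γ : SL(2, ℤ)) 0 1 * (γ' : SL(2, ℤ)) 1 1 = 0 :=
        Int.natAbs_eq_zero.mp (by omega)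
      have hdetβ := Matrix.SpecialLinearGroup.det_coe ((γ⁻¹ * γ' : Gamma0 N) : SL(2, ℤ))
      rw [Matrix.det_fin_two, e01, hz, zero_mul, sub_zero] at hdetβ
      refine hsmall _ ?_
      rcases Int.eq_one_or_neg_one_of_mul_eq_one' hdetβ with ⟨h1, h2⟩ | ⟨h1, h2⟩ <;> rw [h1, h2] <;> rfl
    · exact hB1 _ (by rw [e01]; omega)
  have h := hadd γ (γ⁻¹ * γ')
  rw [mul_inv_cancel_left, hβ, add_zero] at h
  exact h.symm

/-- An element of `Γ₀(N)` with prescribed second column `(b, d)`: it exists as soon as `gcd(b, d) = 1` and `d` is prime to `N`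
(`α d + κ N b = 1`). [folklore] -/
theorem exists_gamma0_secondCol (b d : ℤ) (hbd : IsCoprime b d) (hdN : IsCoprime d N) :
    ∃ γ : Gamma0 N, (γ : SL(2, ℤ)) 0 1 = b ∧ (γ : SL(2, ℤ)) 1 1 = d := by
  have h : IsCoprime d ((N : ℤ) * b) := IsCoprime.mul_right hdN hbd.symm
  obtain ⟨u, v, huv⟩ := h
  obtain ⟨γ, -, h01, -, h11⟩ := ThetaLayerLambdaCongruenceAtTwo.exists_gamma0_entries (N := N) u b (-((N : ℤ) * v)) d
    (by linear_combination huv) ⟨-v, by ring⟩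
  exact ⟨γ, h01, h11⟩

/-- **`−I` twist**: `χ γ` is unchanged on replacing `γ` by `γ·(−I)`, whose second column is `(−b, −d)`. [folklore] -/
theorem exists_neg (hadd : ∀ γ δ : Gamma0 N, χ (γ * δ) = χ γ + χ δ)
    (hsmall : ∀ γ : Gamma0 N, ((γ : SL(2, ℤ)) 0 0 + (γ : SL(2, ℤ)) 1 1).natAbs ≤ 2 → χ γ = 0) (γ : Gamma0 N) :
    ∃ γ' : Gamma0 N, (γ' : SL(2, ℤ)) 0 1 = -(γ : SL(2, ℤ)) 0 1 ∧ (γ' : SL(2, ℤ)) 1 1 = -(γ : SL(2, ℤ)) 1 1 ∧ χ γ' = χ γ := by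
  obtain ⟨J, hJ00, hJ01, hJ10, hJ11⟩ :=
    ThetaLayerLambdaCongruenceAtTwo.exists_gamma0_entries (N := N) (-1) 0 0 (-1) (by ring) (dvd_zero _)
  have hJ : χ J = 0 := hsmall J (by rw [hJ00, hJ11]; rfl)
  refine ⟨γ * J, ?_, ?_, ?_⟩
  · rw [gamma0_mul_apply_zero_one, hJ01, hJ11]; ring
  · rw [gamma0_mul_apply_one_one', hJ01, hJ11]; ring
  · rw [hadd, hJ, add_zero]

/-- **`|d| ≤ 1` elements are killed**: `d = 0` is impossible for `N ≥ 2`, and for `d = ±1` the element `T^{−bd}·γ` has `b = 0`, hence is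
`±(1 0; * 1)` (trace `±2`). [folklore] -/
theorem chi_eq_zero_of_natAbs_d_le_one (hN : 2 ≤ N) (hadd : ∀ γ δ : Gamma0 N, χ (γ * δ) = χ γ + χ δ)
    (hsmall : ∀ γ : Gamma0 N, ((γ : SL(2, ℤ)) 0 0 + (γ : SL(2, ℤ)) 1 1).natAbs ≤ 2 → χ γ = 0) (γ : Gamma0 N)
    (hd : ((γ : SL(2, ℤ)) 1 1).natAbs ≤ 1) : χ γ = 0 := by
  set a := (γ : SL(2, ℤ)) 0 0 with hadef
  set b := (γ : SL(2, ℤ)) 0 1 with hbdef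
  set c := (γ : SL(2, ℤ)) 1 0 with hcdef
  set d := (γ : SL(2, ℤ)) 1 1 with hddef
  have hdet : a * d - b * c = 1 := by
    have := Matrix.SpecialLinearGroup.det_coe (γ : SL(2, ℤ))
    rwa [Matrix.det_fin_two] at this
  have hcN : (N : ℤ) ∣ c := by
    have h := γ.2
    rw [Gamma0_mem] at h
    exact (ZMod.intCast_zmod_eq_zero_iff_dvd _ N).mp h
  rcases Nat.lt_or_ge d.natAbs 1 with h0 | h1
  · -- `d = 0`: `b c = -1`, so `N ∣ c = ±1`, contradicting `N ≥ 2`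
    exfalso
    have hd0 : d = 0 := Int.natAbs_eq_zero.mp (by omega)
    rw [hd0, mul_zero, zero_sub] at hdet
    have hc1 : c.natAbs = 1 := by
      have h := congrArg Int.natAbs hdet
      rw [Int.natAbs_neg, Int.natAbs_mul] at h
      exact Nat.eq_one_of_mul_eq_one_left (by simpa using h)
    obtain ⟨t, ht⟩ := hcN
    have h := congrArg Int.natAbs ht
    rw [hc1, Int.natAbs_mul, Int.natAbs_natCast] at h
    have hN1 : N ∣ 1 := ⟨t.natAbs, h⟩
    have := Nat.le_of_dvd one_pos hN1
    omega
  · -- `d = ±1`: multiply on the left by `T^{-b d}`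
    have hd1 : d * d = 1 := by
      have h1 : d.natAbs = 1 := le_antisymm hd h1
      rcases Int.natAbs_eq d with h | h <;> rw [h1] at h <;> rw [h] <;> norm_num
    obtain ⟨T, hT00, hT01, hT10, hT11⟩ :=
      ThetaLayerLambdaCongruenceAtTwo.exists_gamma0_entries (N := N) 1 (-(b * d)) 0 1 (by ring) (dvd_zero _)
    have hT : χ T = 0 := hsmall T (by rw [hT00, hT11]; rfl)
    have e01 : ((T * γ : Gamma0 N) : SL(2, ℤ)) 0 1 = 0 := by
      rw [gamma0_mul_apply_zero_one, hT00, hT01, ← hbdef, ← hddef]; linear_combination (-b) * hd1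
    have e11 : ((T * γ : Gamma0 N) : SL(2, ℤ)) 1 1 = d := by
      rw [gamma0_mul_apply_one_one', hT10, hT11, ← hbdef, ← hddef]; ring
    have hdet' := Matrix.SpecialLinearGroup.det_coe ((T * γ : Gamma0 N) : SL(2, ℤ))
    rw [Matrix.det_fin_two, e01, e11, zero_mul, sub_zero] at hdet'
    have hTγ : χ (T * γ) = 0 := by
      refine hsmall _ ?_
      rw [e11]
      rcases Int.eq_one_or_neg_one_of_mul_eq_one' hdet' with ⟨h1, h2⟩ | ⟨h1, h2⟩ <;> rw [h1, h2] <;> rfl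
    exact chi_eq_zero_of_mul_left hadd hTγ hT

/-! ## §2. Arithmetic at `N = p^a q`, `a ≤ 2`: good residues, the two-bad-parents dichotomy, the parabolic divisibility -/

section Arith

variable {p q a : ℕ}

/-- At `N = p^a q`: `d` is prime to `N` iff neither `p` nor `q` divides `d`. [folklore] -/
theorem isCoprime_iff_not_dvd (hp : p.Prime) (hq : q.Prime) (ha : 1 ≤ a) (hN : N = p ^ a * q) (d : ℤ) :
    IsCoprime d (N : ℤ) ↔ ¬ (p : ℤ) ∣ d ∧ ¬ (q : ℤ) ∣ d := by
  have hp' : Prime (p : ℤ) := Nat.prime_iff_prime_int.mp hp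
  have hq' : Prime (q : ℤ) := Nat.prime_iff_prime_int.mp hq
  have hNz : (N : ℤ) = (p : ℤ) ^ a * q := by rw [hN]; push_cast; ring
  constructor
  · intro h
    have hpN : (p : ℤ) ∣ (N : ℤ) := by rw [hNz]; exact (dvd_pow_self _ (by omega)).mul_right _
    have hqN : (q : ℤ) ∣ (N : ℤ) := by rw [hNz]; exact dvd_mul_left _ _
    refine ⟨fun hpd ↦ hp'.not_unit (h.isUnit_of_dvd' hpd hpN), fun hqd ↦ hq'.not_unit (h.isUnit_of_dvd' hqd hqN)⟩
  · rintro ⟨hpd, hqd⟩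
    rw [hNz]
    refine IsCoprime.mul_right (IsCoprime.pow_right ?_) ?_
    · exact ((hp'.irreducible.coprime_iff_not_dvd).mpr hpd).symm
    · exact ((hq'.irreducible.coprime_iff_not_dvd).mpr hqd).symm

/-- **Two bad coprime residues split the primes**: at `N = p^a q`, if `d₁, d₂` are coprime and neither is prime to `N`, then one of them is
divisible by `p` and not by `q`, the other by `q` and not by `p`. [folklore] -/
theorem split_of_bad_bad (hp : p.Prime) (hq : q.Prime) (ha : 1 ≤ a) (hN : N = p ^ a * q) {d₁ d₂ : ℤ}
    (hcop : IsCoprime d₁ d₂) (h₁ : ¬ IsCoprime d₁ (N : ℤ)) (h₂ : ¬ IsCoprime d₂ (N : ℤ)) :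
    ((p : ℤ) ∣ d₁ ∧ ¬ (q : ℤ) ∣ d₁ ∧ (q : ℤ) ∣ d₂ ∧ ¬ (p : ℤ) ∣ d₂) ∨
      ((p : ℤ) ∣ d₂ ∧ ¬ (q : ℤ) ∣ d₂ ∧ (q : ℤ) ∣ d₁ ∧ ¬ (p : ℤ) ∣ d₁) := by
  have hp' : Prime (p : ℤ) := Nat.prime_iff_prime_int.mp hp
  have hq' : Prime (q : ℤ) := Nat.prime_iff_prime_int.mp hq
  rw [isCoprime_iff_not_dvd hp hq ha hN] at h₁ h₂
  -- a common prime divisor of `d₁, d₂` is impossible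
  have key : ∀ r : ℤ, Prime r → r ∣ d₁ → r ∣ d₂ → False :=
    fun r hr hr1 hr2 ↦ hr.not_unit (hcop.isUnit_of_dvd' hr1 hr2)
  by_cases hpd1 : (p : ℤ) ∣ d₁
  · have hpd2 : ¬ (p : ℤ) ∣ d₂ := fun h ↦ key _ hp' hpd1 h
    have hqd2 : (q : ℤ) ∣ d₂ := by by_contra h; exact h₂ ⟨hpd2, h⟩
    have hqd1 : ¬ (q : ℤ) ∣ d₁ := fun h ↦ key _ hq' h hqd2
    exact Or.inl ⟨hpd1, hqd1, hqd2, hpd2⟩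
  · have hqd1 : (q : ℤ) ∣ d₁ := by by_contra h; exact h₁ ⟨hpd1, h⟩
    have hqd2 : ¬ (q : ℤ) ∣ d₂ := fun h ↦ key _ hq' hqd1 h
    have hpd2 : (p : ℤ) ∣ d₂ := by by_contra h; exact h₂ ⟨h, hqd2⟩
    exact Or.inr ⟨hpd2, hqd2, hqd1, hpd1⟩

/-- **The parabolic divisibility** (the only place where `a ≤ 2` is used): at `N = p^a q` with `a ≤ 2`, `p ∣ s` gives `N ∣ q s²`. [folklore] -/
theorem dvd_mul_sq (ha : a ≤ 2) (hN : N = p ^ a * q) {s : ℤ} (hs : (p : ℤ) ∣ s) : (N : ℤ) ∣ (q : ℤ) * s ^ 2 := by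
  obtain ⟨s₁, rfl⟩ := hs
  have hNz : (N : ℤ) = (p : ℤ) ^ a * q := by rw [hN]; push_cast; ring
  rw [hNz]
  have hpa : (p : ℤ) ^ a ∣ (p : ℤ) ^ 2 := pow_dvd_pow _ ha
  obtain ⟨m, hm⟩ := hpa
  exact ⟨m * s₁ ^ 2, by linear_combination (q : ℤ) * s₁ ^ 2 * hm⟩

end Arith

end TwoPrimes

end Summit.BirchSwinnertonDyer.BirchSwinnertonDyer.Theorems.SignedMuAtTwo
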